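import Summits.Ventures.HSemireg.WedgeHankelRecurrenceSchurCohnRoots
import Summits.Ventures.HSemireg.WedgeHankelRecurrenceRouthHurwitz

/-!
# Venture HSemireg — SCHUR–COHN FOR REAL POLYNOMIALS BY SIGNATURE: for `p ∈ ℝ[X]` of degree `n` the REAL SYMMETRIC Schur–Cohn matrix `S_n(p) = B_n(reverse p, p)·J` (`p^♯ = reflect n p`, no conjugation)
# has, when `p ⊥ reflect n p`, **`sigPos S_n(p) = #{complex roots with |z| < 1}`, `sigNeg S_n(p) = #{|z| > 1}`**, `sigPos + sigNeg = n`; and UNCONDITIONALLY **`p` is a (real) Schur polynomial —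
# every complex root in the open unit disc — iff `S_n(p)` is positive definite iff `sigPos S_n(p) = n`** (discrete-time ∕ Jury-type stability, read on Mathlib's `sigPos`)

HONEST FRAMING. Part of the Lean index of the computation cell `pub-hsemireg` (seat p10 gen 38, Sunday typer «UNIFORM-IN-n»).
LINEAR ALGEBRA OF REAL SYMMETRIC ∕ COMPLEX HERMITIAN MATRICES AND POLYNOMIALS ONLY (Mathlib `sigPos` ∕ `sigNeg`, `Matrix.PosDef`; PROVED Literature `Weil1964/RealWeilIndexSignature` via N187's bridge):
no variety, no cohomology theory, no sheaf, no Ext group and no semiregularity map is constructed here; nothing here says that HC / HC_CM / HC_AV holds; no Literature fact (unproved `Prop`) is declared or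
used.  Custodian versions as in `WedgeHankelSiegelIdeal` (1/3).
SOURCE.  As N193/N194: the Schur–Cohn criterion (Schur 1917, Cohn 1922; real form = Jury-type discrete stability tests) CITED FROM MEMORY, no held printed statement; every statement below is PROVED in the
tree from N194 by complexification exactly as N187 derives the real Routh–Hurwitz reading from N186.
DICTIONARY.  For REAL `p`: `reciprocal n p = reflect n p` (trivial star; for `deg p = n` this is Mathlib's `p.reverse`), `S_n(p)_{ij} = b_{i,n−1−j}(reflect n p, p)` real symmetric (`schurCohn_isHermitian`
over `ℝ`); `S_n(p) ⊗ ℂ = S_n(p_ℂ)`; «complex roots» = `(p.map (algebraMap ℝ ℂ)).roots`.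
DEDUP DISCLOSURE (`rg` of the whole tree + Mathlib, 2026-09-02): no Schur ∕ Jury stability criterion for polynomials in the tree (Literature `SteinInertiaTheorem`: matrices); N187 is the half-plane twin.
8 names: 0 hits tree-wide.

WHAT IS IN THE TREE.  N193: `reciprocal`, `schurCohn`, `schurCohn_apply`, `schurCohn_isHermitian`, `reflect_map`; N194: `card_pos/neg_eigenvalues_schurCohn`, `countP_norm_lt_add_countP_norm_gt`,
`posDef_schurCohn_iff`; N187: `card_eigenvalues_map_ofReal`; N184: `card_eigenvalues_congr`; N183: `bezCoeff_map`, `map_starRingEnd_eq_self_of_trivialStar`; Literature `Weil1964.RealWeilIndexSignature.sigPos/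
sigNeg_toQuadraticForm'`.  Mathlib: `Polynomial.isCoprime_map`, `Matrix.IsHermitian.posDef_iff_eigenvalues_pos`.
THIS FILE (namespace `Summit.Ventures.HSemireg.Wedge.HankelOuter` continued; CHAINED on N194 + N187; 0 definitions):
* §874 `reciprocal_map_ofReal` (`(p_ℂ)^♯ = (p^♯)_ℂ`), `schurCohn_map_ofReal` (`S_n(p).map ofReal = S_n(p_ℂ)`), `isCoprime_reciprocal_map_ofReal_iff`, `schurCohn_map_ofReal_isHermitian`.
* §875 **`sigPos_schurCohn_real`** (`= #{‖z‖ < 1}`), **`sigNeg_schurCohn_real`** (`= #{1 < ‖z‖}`), `sigPos_add_sigNeg_schurCohn_real` (`= n`), for `p ⊥ reflect n p`, `deg p = n`.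
* §876 UNCONDITIONAL: **`posDef_schurCohn_real_iff`** (`S_n(p) ≻ 0 ⟺ ∀ z ∈ roots p_ℂ, ‖z‖ < 1`), **`forall_norm_lt_one_iff_sigPos_eq`** (`⟺ sigPos S_n(p) = n`).
CAVEATS.  Jury's tabular test ∕ Schur–Cohn determinants are not typed.  Nothing Ext-side.  New names only.
-/

open Module Polynomial
open scoped Matrix Polynomial ComplexConjugate ComplexOrder

namespace Summit.Ventures.HSemireg.Wedge.HankelOuter

open Summit.Ventures.HSemireg.Wedge Summit.Ventures.HSemireg.Wedge.Hankel
open Literature.LinearAlgebra.Matrix.Bezoutian (bezCoeff)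

/-! ## §874. Real ⇄ complex for the Schur–Cohn matrix -/

/-- **`(p_ℂ)^♯ = (p^♯)_ℂ`**: the reciprocal commutes with `ℝ → ℂ` (conjugation fixes real coefficients). [this file, §874] -/
theorem reciprocal_map_ofReal (n : ℕ) (p : ℝ[X]) : reciprocal n (p.map (algebraMap ℝ ℂ)) = (reciprocal n p).map (algebraMap ℝ ℂ) := by
  have hconj : (p.map (algebraMap ℝ ℂ)).map (starRingEnd ℂ) = p.map (algebraMap ℝ ℂ) := by
    rw [Polynomial.map_map]
    congr 1
    ext x
    simp only [RingHom.coe_comp, Function.comp_apply, Complex.coe_algebraMap, Complex.conj_ofReal]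
  rw [reciprocal, hconj, reflect_map, reciprocal, map_starRingEnd_eq_self_of_trivialStar]

/-- **`S_n(p) ⊗ ℂ = S_n(p_ℂ)`** for a real polynomial. [this file, §874] -/
theorem schurCohn_map_ofReal (n : ℕ) (p : ℝ[X]) : (schurCohn n p).map (algebraMap ℝ ℂ) = schurCohn n (p.map (algebraMap ℝ ℂ)) := by
  ext i j
  rw [Matrix.map_apply, schurCohn_apply, schurCohn_apply, reciprocal_map_ofReal, bezCoeff_map]

/-- **`p_ℂ ⊥ (p_ℂ)^♯ ⟺ p ⊥ p^♯`** (`p^♯ = reflect n p` for real `p`). [this file, §874] -/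
theorem isCoprime_reciprocal_map_ofReal_iff (n : ℕ) (p : ℝ[X]) : IsCoprime (p.map (algebraMap ℝ ℂ)) (reciprocal n (p.map (algebraMap ℝ ℂ))) ↔ IsCoprime p (reciprocal n p) := by
  rw [reciprocal_map_ofReal, Polynomial.isCoprime_map]

/-- The complexified matrix is Hermitian (`deg p ≤ n`). [bookkeeping] -/
theorem schurCohn_map_ofReal_isHermitian {n : ℕ} {p : ℝ[X]} (hp : p.natDegree ≤ n) : ((schurCohn n p).map (algebraMap ℝ ℂ)).IsHermitian := by
  rw [schurCohn_map_ofReal]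
  exact schurCohn_isHermitian (by rwa [Polynomial.natDegree_map_eq_of_injective (RingHom.injective _)])

/-! ## §875. Schur–Cohn by signature (real polynomials) -/

/-- **SCHUR–COHN BY SIGNATURE, positive index: for a real `p` of degree `n` with `p ⊥ reflect n p`, `sigPos (vᵀ S_n(p) v) = #{complex roots of p with ‖z‖ < 1}`.** [this file, §875] -/
theorem sigPos_schurCohn_real {n : ℕ} {p : ℝ[X]} (hp : p.natDegree = n) (hcop : IsCoprime p (reciprocal n p)) :
    sigPos (schurCohn n p).toQuadraticForm' = (p.map (algebraMap ℝ ℂ)).roots.countP (fun z => ‖z‖ < 1) := by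
  have hp' : (p.map (algebraMap ℝ ℂ)).natDegree = n := by rw [Polynomial.natDegree_map_eq_of_injective (RingHom.injective _), hp]
  rw [Literature.NumberTheory.Weil1964.sigPos_toQuadraticForm' (schurCohn_isHermitian hp.le), ← card_eigenvalues_map_ofReal (schurCohn_isHermitian hp.le) (schurCohn_map_ofReal_isHermitian hp.le),
    card_eigenvalues_congr (schurCohn_map_ofReal n p) (schurCohn_map_ofReal_isHermitian hp.le) (schurCohn_isHermitian hp'.le) (0 < ·),
    card_pos_eigenvalues_schurCohn hp' ((isCoprime_reciprocal_map_ofReal_iff n p).2 hcop)]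

/-- **SCHUR–COHN BY SIGNATURE, negative index: `sigNeg (vᵀ S_n(p) v) = #{complex roots of p with 1 < ‖z‖}`.** [this file, §875] -/
theorem sigNeg_schurCohn_real {n : ℕ} {p : ℝ[X]} (hp : p.natDegree = n) (hcop : IsCoprime p (reciprocal n p)) :
    sigNeg (schurCohn n p).toQuadraticForm' = (p.map (algebraMap ℝ ℂ)).roots.countP (fun z => 1 < ‖z‖) := by
  have hp' : (p.map (algebraMap ℝ ℂ)).natDegree = n := by rw [Polynomial.natDegree_map_eq_of_injective (RingHom.injective _), hp]
  have h1 := card_eigenvalues_map_ofReal (schurCohn_isHermitian hp.le) (schurCohn_map_ofReal_isHermitian hp.le) (fun x => x < 0)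
  have h2 := card_eigenvalues_congr (schurCohn_map_ofReal n p) (schurCohn_map_ofReal_isHermitian hp.le) (schurCohn_isHermitian hp'.le) (fun x => x < 0)
  have h3 := card_neg_eigenvalues_schurCohn hp' ((isCoprime_reciprocal_map_ofReal_iff n p).2 hcop)
  rw [Literature.NumberTheory.Weil1964.sigNeg_toQuadraticForm' (schurCohn_isHermitian hp.le), ← h1, h2, h3]

/-- **`sigPos + sigNeg = n`** (no complex root on the unit circle). [this file, §875] -/
theorem sigPos_add_sigNeg_schurCohn_real {n : ℕ} {p : ℝ[X]} (hp : p.natDegree = n) (hcop : IsCoprime p (reciprocal n p)) :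
    sigPos (schurCohn n p).toQuadraticForm' + sigNeg (schurCohn n p).toQuadraticForm' = n := by
  rw [sigPos_schurCohn_real hp hcop, sigNeg_schurCohn_real hp hcop]
  exact countP_norm_lt_add_countP_norm_gt (by rw [Polynomial.natDegree_map_eq_of_injective (RingHom.injective _), hp]) ((isCoprime_reciprocal_map_ofReal_iff n p).2 hcop)

/-! ## §876. Schur stability of a real polynomial, unconditional -/

/-- **A real polynomial `p` of degree `n` has ALL its complex roots in the open unit disc iff the real symmetric matrix `S_n(p)` is positive definite** (complexification + N194). [this file, §876] -/
theorem posDef_schurCohn_real_iff {n : ℕ} {p : ℝ[X]} (hp : p.natDegree = n) : (schurCohn n p).PosDef ↔ ∀ z ∈ (p.map (algebraMap ℝ ℂ)).roots, ‖z‖ < 1 := by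
  have hp' : (p.map (algebraMap ℝ ℂ)).natDegree = n := by rw [Polynomial.natDegree_map_eq_of_injective (RingHom.injective _), hp]
  rw [← posDef_schurCohn_iff hp', ← schurCohn_map_ofReal, (schurCohn_isHermitian hp.le).posDef_iff_eigenvalues_pos, (schurCohn_map_ofReal_isHermitian hp.le).posDef_iff_eigenvalues_pos]
  constructor
  · intro h i
    have hcard := card_eigenvalues_map_ofReal (schurCohn_isHermitian hp.le) (schurCohn_map_ofReal_isHermitian hp.le) (0 < ·)
    rw [Finset.filter_true_of_mem (s := Finset.univ) fun i _ => h i, Finset.card_univ] at hcard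
    have hall := Finset.eq_univ_of_card _ hcard
    have := Finset.mem_univ i
    rw [← hall, Finset.mem_filter] at this
    exact this.2
  · intro h i
    have hcard := card_eigenvalues_map_ofReal (schurCohn_isHermitian hp.le) (schurCohn_map_ofReal_isHermitian hp.le) (0 < ·)
    rw [Finset.filter_true_of_mem (s := Finset.univ) fun i _ => h i, Finset.card_univ] at hcard
    have hall := Finset.eq_univ_of_card _ hcard.symm
    have := Finset.mem_univ i
    rw [← hall, Finset.mem_filter] at this
    exact this.2

/-- **… iff `sigPos (vᵀ S_n(p) v) = n`.** [this file, §876] -/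
theorem forall_norm_lt_one_iff_sigPos_eq {n : ℕ} {p : ℝ[X]} (hp : p.natDegree = n) : (∀ z ∈ (p.map (algebraMap ℝ ℂ)).roots, ‖z‖ < 1) ↔ sigPos (schurCohn n p).toQuadraticForm' = n := by
  rw [← posDef_schurCohn_real_iff hp, (schurCohn_isHermitian hp.le).posDef_iff_eigenvalues_pos, Literature.NumberTheory.Weil1964.sigPos_toQuadraticForm' (schurCohn_isHermitian hp.le)]
  constructor
  · intro h
    rw [Finset.filter_true_of_mem fun i _ => h i, Finset.card_univ, Fintype.card_fin]
  · intro h i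
    have hall := Finset.eq_univ_of_card _ (h.trans (Fintype.card_fin n).symm)
    have := Finset.mem_univ i
    rw [← hall, Finset.mem_filter] at this
    exact this.2

end Summit.Ventures.HSemireg.Wedge.HankelOuter
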